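import Summits.BirchSwinnertonDyer.BirchSwinnertonDyer.Theorems.ErratumRoadFiveIMCDivTransferTorsionOnly
import HarnessLib

/-!
# K2 crux 19270 `IMCDivAtErratumDataAll` (H3♭), ROAD FF — the end forms with Lemma 2.1 in its
# most general kernel shape: DIVISIBLE invariants (not only vanishing socles)

Cell `bsd-stepL`, seat `bsd-stepL-imc-p1` (g7). `--supports stmt-BirchSwinnertonDyer-19270 --as helper`.
HONEST FRAMING: BSD is not proved for any pair by this file; it closes no item; no definition, no
named fact, no `sorry`. Sequel of p470728 (`…TransferTwoRing`), p474991 (`…CharIdealTransferTorsion`,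
the 𝔪^k-trick) and p475740 (`…TransferTorsionOnly`).

## Why a third shape of the Galois-side hypotheses

The torsion-control lemma (erratum Lemma 2.1) enters the transfer through the kernel theorem
`TorsionControl.selmerTorsionEquiv` (`X11b/SelmerTorsionControl.lean`), whose hypotheses are, for the
exponent `r = a^m`: `M` is `r`-divisible, the global invariants `M^Γ` are `r`-divisible, and for
every CONSTRAINED index `v ∈ L₀` the local invariants `M^{Γ_v}` are `r`-divisible. The end forms
landed so far (tree gen 4/5, p470728, p475740) specialise this to "invariants `= ⊥`" (or the socle
form "no invariants in `M[I]`"). That specialisation fits the model `Γ₀ = G_{K,S}`, `L₀ = {𝔭}` of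
[Cas18, §2.1] / erratum Lemma 2.1 — but NOT a model in which `Γ₀ = G_K` and the condition
"unramified outside `S`" is imposed through INERTIA indices `Γ_v = I_w` (`w ∉ S`): there `I_w` acts
trivially on `M = T ⊗ Λ^*`, so `M^{I_w} = M ≠ ⊥`, while `M^{I_w} = M` IS `a^m`-divisible — the
divisible form holds trivially (the D1 typer's note, STATUS 2026-08-26T23:32:35Z). So that the glue
serves WHICHEVER model the definition `bigRep` (D1) lands in, this file re-derives the three end
forms with the divisible-invariants hypotheses VERBATIM from `selmerTorsionEquiv`:

* §1 `TorsionControl.nonempty_torsionBy_selmer_equiv_of_divisible` — (b) + Lemma 2.1: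
  `Sel(M_f)[a^m] ≃ Sel(M_{g_m})[a^m]` (gen 4's `nonempty_torsionBy_selmer_equiv` with divisible
  instead of vanishing invariants).
* §2 `TorsionControl.map_fittingIdeal_le_span_of_selmer_congruences_divisible` — FITTING level,
  ANY Noetherian UFD coefficient ring `R` and ANY Noetherian `R`-algebra `S` carrying `L_f`, `L_m`,
  F3, F4: `Fitt_R(Sel(M_f)^∨)·S ⊆ (L_f)` — NO input on `X_f` at all.
* §3 `TorsionControl.map_charIdeal_le_span_of_selmer_congruences_divisible` — `R = 𝒪⟦T⟧`,
  `S = 𝒪'⟦T⟧` (`𝒪 → 𝒪'` injective, DVR → PID), `X_f` TORSION: `Ch(X_f)·𝒪'⟦T⟧ ⊆ (L_f)` by the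
  𝔪^k-trick (no erratum Lemma 2.2).
* §4 `AcSelmer.XAc.map_charIdeal_le_span_of_roadFF_divisible` — the crux conjunct
  `(XAc.charIdeal W p κ 𝔭 ∅ γ).map (PowerSeries.map (R1.toCpInt p)) ≤ Ideal.span {Q}` VERBATIM.

Dictionary of hypotheses (D1 ∕ D2 ∕ F1–F5 ∕ F7) as in p470728's module docstring; F5 now reads:
"`M_f^{Γ₀}` and `M_f^{Γ_v}` (`v ∈ L₀`) are `a^m`-divisible" — at `Γ₀ = G_{K,S}`, `v = 𝔭` this is
`= 0` by irreducibility of `ρ̄|_{G_K}` [Ski20 Lem. 2.8.1] and (iv) `E(ℚ_p)[p] = 0`; at inertia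
indices it is divisibility of `M`.

References: [Castella2018Erratum] Lemma 2.1 and proof of Thm. 1.1 (p. 4); [Skinner2016PacificMC]
§2.3 Lemma 2.3.1 (proof: "(𝓜⁻)^{I_p} … is p-divisible"), §3.1; [Castella2018] §2.1.
-/

noncomputable section

open scoped TensorProduct
open Literature.RingTheory.FittingIdeal Literature.NumberTheory.EllipticCurves
  Literature.NumberTheory.EllipticCurves.Module

/-! ### §1 (b) + Lemma 2.1 with divisible invariants -/

namespace Summit.BirchSwinnertonDyer.Rank1Residual.X11b.TorsionControl

open CategoryTheory Literature.NumberTheory.GaloisRepresentations IsLocalRing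
open scoped ContRepresentation

universe u v

section General

variable {R : Type u} [CommRing R] [TopologicalSpace R]
variable {Γ : Type u} [Group Γ] [TopologicalSpace Γ] [IsTopologicalGroup Γ]
variable {ι : Type*} {Γv : ι → Type u} [∀ v, Group (Γv v)] [∀ v, TopologicalSpace (Γv v)]
  [∀ v, IsTopologicalGroup (Γv v)] (φ : ∀ v, Γv v →ₜ* Γ) (L : Set ι)

/-- **(b) + Lemma 2.1 ⟹ `Sel(M_f)[a^m] ≃ Sel(M_g)[a^m]`, divisible-invariants form.** For two
discrete `R`-linear `Γ`-modules that are `a`-divisible and whose global invariants and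
constrained-local invariants (`v ∈ L`) are `a^m`-DIVISIBLE (e.g. zero; or all of `M` at an
inertia index acting trivially), an isomorphism `θ` of their `a^m`-torsion subrepresentations
induces an `R`-linear isomorphism of the `a^m`-torsion of their Selmer groups
(`selmerTorsionEquiv` on both sides, `selmerCongr` in between).
[cite: Castella2018Erratum, Lemma 2.1 and proof of Thm. 1.1 (b)] [cite: Skinner2016PacificMC, §2.3, proof of Lemma 2.3.1] -/
theorem nonempty_torsionBy_selmer_equiv_of_divisible (a : R) (m : ℕ) {Mf : Type u}
    [AddCommGroup Mf] [Module R Mf] [TopologicalSpace Mf] [DiscreteTopology Mf]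
    [ContinuousSMul R Mf] {Mg : Type u} [AddCommGroup Mg] [Module R Mg] [TopologicalSpace Mg]
    [DiscreteTopology Mg] [ContinuousSMul R Mg] (ρf : ContinuousRep Γ R Mf)
    (ρg : ContinuousRep Γ R Mg)
    (hdivf : Function.Surjective fun x : Mf => a • x)
    (hglobf : ∀ w ∈ ρf.toTopRep.ρ.invariants, ∃ w' ∈ ρf.toTopRep.ρ.invariants, a ^ m • w' = w)
    (hlocf : ∀ v ∈ L, ∀ w ∈ ((ρf.restrict (φ v)).toTopRep).ρ.invariants,
      ∃ w' ∈ ((ρf.restrict (φ v)).toTopRep).ρ.invariants, a ^ m • w' = w)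
    (hdivg : Function.Surjective fun x : Mg => a • x)
    (hglobg : ∀ w ∈ ρg.toTopRep.ρ.invariants, ∃ w' ∈ ρg.toTopRep.ρ.invariants, a ^ m • w' = w)
    (hlocg : ∀ v ∈ L, ∀ w ∈ ((ρg.restrict (φ v)).toTopRep).ρ.invariants,
      ∃ w' ∈ ((ρg.restrict (φ v)).toTopRep).ρ.invariants, a ^ m • w' = w)
    (θ : (torsionRep ρg (a ^ m)).toTopRep ≅ (torsionRep ρf (a ^ m)).toTopRep) :
    Nonempty (Submodule.torsionBy R (selmer φ L ρf) (a ^ m) ≃ₗ[R]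
      Submodule.torsionBy R (selmer φ L ρg) (a ^ m)) :=
  ⟨(selmerTorsionEquiv φ L ρf (a ^ m) (surjective_pow_smul a hdivf m) hglobf hlocf).symm.trans
    ((selmerCongr φ L θ).symm.trans
      (selmerTorsionEquiv φ L ρg (a ^ m) (surjective_pow_smul a hdivg m) hglobg hlocg))⟩

/-! ### §2 The Fitting-level two-ring end form (any Noetherian UFD `R`, any Noetherian `S`) -/

/-- **`Fitt_R(Sel(M_f)^∨)·S ⊆ (L_f)` — the two-ring one-sided transfer at FITTING level, divisible-
invariants form, for ANY Noetherian UFD coefficient ring `R` (`Λ_𝒪`) and ANY Noetherian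
`R`-algebra `S` (`Λ_𝒪^{ur}`) with `(a)S ⊆ Jac S`.** Inputs: discrete `R`-linear `Γ`-modules `M_f`
(D1), `M_{g_m}` (D2), `a`-divisible, with `a^m`-divisible global and constrained-local invariants
(F5 — Lemma 2.1's hypotheses in the shape `selmerTorsionEquiv` consumes); `θ m` (F2 = Hida (b));
finite generation of the dual Selmer groups; in `S`: `hCh m` (F4 = "`Ch_R(Sel(M_{g_m})^∨)·S ⊆
(L_m)` when torsion", [FW21, Thm. 4.41] for the crystalline `g_m`) and `hc m` (F3 = (c), [Cas20,
Thm. 2.11]). Output: `Fitt_R(X_f)·S ⊆ (L_f)`. NO input on `X_f = Sel(M_f)^∨` whatsoever.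
[cite: Castella2018Erratum, Lemma 2.1 and proof of Thm. 1.1 (p. 4), read one-sidedly]
[cite: Skinner2016PacificMC, §3.1 (p. 192)] [cite: StacksProject, Tag 07ZA] -/
theorem map_fittingIdeal_le_span_of_selmer_congruences_divisible
    [IsNoetherianRing R] [IsDomain R] [UniqueFactorizationMonoid R] (a : R)
    {Mf : Type u} [AddCommGroup Mf] [Module R Mf] [TopologicalSpace Mf] [DiscreteTopology Mf]
    [ContinuousSMul R Mf] (ρf : ContinuousRep Γ R Mf)
    (hdivf : Function.Surjective fun x : Mf => a • x)
    (hglobf : ∀ m, 1 ≤ m → ∀ w ∈ ρf.toTopRep.ρ.invariants,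
      ∃ w' ∈ ρf.toTopRep.ρ.invariants, a ^ m • w' = w)
    (hlocf : ∀ m, 1 ≤ m → ∀ v ∈ L, ∀ w ∈ ((ρf.restrict (φ v)).toTopRep).ρ.invariants,
      ∃ w' ∈ ((ρf.restrict (φ v)).toTopRep).ρ.invariants, a ^ m • w' = w)
    (Mg : ℕ → Type u) [∀ m, AddCommGroup (Mg m)] [∀ m, Module R (Mg m)]
    [∀ m, TopologicalSpace (Mg m)] [∀ m, DiscreteTopology (Mg m)] [∀ m, ContinuousSMul R (Mg m)]
    (ρg : ∀ m, ContinuousRep Γ R (Mg m))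
    (hdivg : ∀ m, 1 ≤ m → Function.Surjective fun x : Mg m => a • x)
    (hglobg : ∀ m, 1 ≤ m → ∀ w ∈ (ρg m).toTopRep.ρ.invariants,
      ∃ w' ∈ (ρg m).toTopRep.ρ.invariants, a ^ m • w' = w)
    (hlocg : ∀ m, 1 ≤ m → ∀ v ∈ L, ∀ w ∈ (((ρg m).restrict (φ v)).toTopRep).ρ.invariants,
      ∃ w' ∈ (((ρg m).restrict (φ v)).toTopRep).ρ.invariants, a ^ m • w' = w)
    (θ : ∀ m, 1 ≤ m → ((torsionRep (ρg m) (a ^ m)).toTopRep ≅ (torsionRep ρf (a ^ m)).toTopRep))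
    [Module.Finite R (CharacterModule (selmer φ L ρf))]
    [∀ m, Module.Finite R (CharacterModule (selmer φ L (ρg m)))]
    (S : Type v) [CommRing S] [Algebra R S] [IsNoetherianRing S]
    (ha : (Ideal.span {a}).map (algebraMap R S) ≤ (⊥ : Ideal S).jacobson)
    {Lf : S} (Lg : ℕ → S)
    (hCh : ∀ m, 1 ≤ m → Module.IsTorsion R (CharacterModule (selmer φ L (ρg m))) →
      (charIdeal R (CharacterModule (selmer φ L (ρg m)))).map (algebraMap R S) ≤
        Ideal.span {Lg m})
    (hc : ∀ m, 1 ≤ m →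
      Ideal.span {Lg m} ⊔ ((Ideal.span {a}).map (algebraMap R S)) ^ m =
        Ideal.span {Lf} ⊔ ((Ideal.span {a}).map (algebraMap R S)) ^ m) :
    (Module.fittingIdeal R (CharacterModule (selmer φ L ρf)) 0).map (algebraMap R S) ≤
      Ideal.span {Lf} :=
  CongruenceLimit.map_fittingIdeal_le_span_of_congruences S
    (fun m => CharacterModule (selmer φ L (ρg m))) (Ideal.span {a}) ha Lg
    (fun m hm => Classical.choice
      (PontryaginCongruence.nonempty_quotIdealPow_equiv_of_torsionBy_equiv a m
        (Classical.choice (nonempty_torsionBy_selmer_equiv_of_divisible φ L a m ρf (ρg m) hdivf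
          (hglobf m hm) (hlocf m hm) (hdivg m hm) (hglobg m hm) (hlocg m hm) (θ m hm)))))
    (fun m hm => CongruenceLimit.map_fittingIdeal_zero_le_of_map_charIdeal_le S (algebraMap R S)
      (hCh m hm)) hc

end General

/-! ### §3 The characteristic-ideal end form, `R = 𝒪⟦T⟧`, `S = 𝒪'⟦T⟧`, torsion only -/

section PowerSeries

open PowerSeries

variable {𝒪 : Type} [CommRing 𝒪] [IsDomain 𝒪] [IsDiscreteValuationRing 𝒪]
  [TopologicalSpace (PowerSeries 𝒪)]
  {𝒪' : Type} [CommRing 𝒪'] [IsDomain 𝒪'] [IsPrincipalIdealRing 𝒪'] [Algebra 𝒪 𝒪']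
variable {Γ₀ : Type} [Group Γ₀] [TopologicalSpace Γ₀] [IsTopologicalGroup Γ₀]
variable {ι₀ : Type*} {Γw : ι₀ → Type} [∀ v, Group (Γw v)] [∀ v, TopologicalSpace (Γw v)]
  [∀ v, IsTopologicalGroup (Γw v)] (ψ : ∀ v, Γw v →ₜ* Γ₀) (L₀ : Set ι₀)

/-- **`Ch_{Λ_𝒪}(Sel(M_f)^∨)·𝒪'⟦T⟧ ⊆ (L_f)`, divisible-invariants + torsion-only form** (`S = 𝒪'⟦T⟧`,
`𝒪 → 𝒪'` injective from a DVR to a PID): §2 over `R = 𝒪⟦T⟧`, then the 𝔪^k-trick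
(`CongruenceLimit.map_charIdeal_le_span_of_map_fittingIdeal_le`) with `X_f` torsion (`hT`). No
erratum Lemma 2.2, no vanishing of invariants — only their `a^m`-divisibility.
[cite: Castella2018Erratum, Lemma 2.1 and proof of Thm. 1.1 (p. 4), read one-sidedly, Lemma 2.2 bypassed]
[cite: Skinner2016PacificMC, §2.6 (2-6-1) and §3.1 (p. 192)] -/
theorem map_charIdeal_le_span_of_selmer_congruences_divisible
    (hι : Function.Injective (algebraMap 𝒪 𝒪')) (a : PowerSeries 𝒪)
    {Mf : Type} [AddCommGroup Mf] [Module (PowerSeries 𝒪) Mf] [TopologicalSpace Mf]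
    [DiscreteTopology Mf] [ContinuousSMul (PowerSeries 𝒪) Mf] (ρf : ContinuousRep Γ₀ (PowerSeries 𝒪) Mf)
    (hdivf : Function.Surjective fun x : Mf => a • x)
    (hglobf : ∀ m, 1 ≤ m → ∀ w ∈ ρf.toTopRep.ρ.invariants,
      ∃ w' ∈ ρf.toTopRep.ρ.invariants, a ^ m • w' = w)
    (hlocf : ∀ m, 1 ≤ m → ∀ v ∈ L₀, ∀ w ∈ ((ρf.restrict (ψ v)).toTopRep).ρ.invariants,
      ∃ w' ∈ ((ρf.restrict (ψ v)).toTopRep).ρ.invariants, a ^ m • w' = w)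
    (Mg : ℕ → Type) [∀ m, AddCommGroup (Mg m)] [∀ m, Module (PowerSeries 𝒪) (Mg m)]
    [∀ m, TopologicalSpace (Mg m)] [∀ m, DiscreteTopology (Mg m)]
    [∀ m, ContinuousSMul (PowerSeries 𝒪) (Mg m)] (ρg : ∀ m, ContinuousRep Γ₀ (PowerSeries 𝒪) (Mg m))
    (hdivg : ∀ m, 1 ≤ m → Function.Surjective fun x : Mg m => a • x)
    (hglobg : ∀ m, 1 ≤ m → ∀ w ∈ (ρg m).toTopRep.ρ.invariants,
      ∃ w' ∈ (ρg m).toTopRep.ρ.invariants, a ^ m • w' = w)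
    (hlocg : ∀ m, 1 ≤ m → ∀ v ∈ L₀, ∀ w ∈ (((ρg m).restrict (ψ v)).toTopRep).ρ.invariants,
      ∃ w' ∈ (((ρg m).restrict (ψ v)).toTopRep).ρ.invariants, a ^ m • w' = w)
    (θ : ∀ m, 1 ≤ m → ((torsionRep (ρg m) (a ^ m)).toTopRep ≅ (torsionRep ρf (a ^ m)).toTopRep))
    [Module.Finite (PowerSeries 𝒪) (CharacterModule (selmer ψ L₀ ρf))]
    [∀ m, Module.Finite (PowerSeries 𝒪) (CharacterModule (selmer ψ L₀ (ρg m)))]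
    (ha : (Ideal.span {a}).map (algebraMap (PowerSeries 𝒪) (PowerSeries 𝒪')) ≤
      (⊥ : Ideal (PowerSeries 𝒪')).jacobson)
    {Lf : PowerSeries 𝒪'} (Lg : ℕ → PowerSeries 𝒪')
    (hCh : ∀ m, 1 ≤ m → Module.IsTorsion (PowerSeries 𝒪) (CharacterModule (selmer ψ L₀ (ρg m))) →
      (charIdeal (PowerSeries 𝒪) (CharacterModule (selmer ψ L₀ (ρg m)))).map
        (algebraMap (PowerSeries 𝒪) (PowerSeries 𝒪')) ≤ Ideal.span {Lg m})
    (hc : ∀ m, 1 ≤ m →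
      Ideal.span {Lg m} ⊔ ((Ideal.span {a}).map (algebraMap (PowerSeries 𝒪) (PowerSeries 𝒪'))) ^ m =
        Ideal.span {Lf} ⊔ ((Ideal.span {a}).map (algebraMap (PowerSeries 𝒪) (PowerSeries 𝒪'))) ^ m)
    (hT : Module.IsTorsion (PowerSeries 𝒪) (CharacterModule (selmer ψ L₀ ρf))) :
    (charIdeal (PowerSeries 𝒪) (CharacterModule (selmer ψ L₀ ρf))).map
        (algebraMap (PowerSeries 𝒪) (PowerSeries 𝒪')) ≤ Ideal.span {Lf} :=
  CongruenceLimit.map_charIdeal_le_span_of_map_fittingIdeal_le (algebraMap 𝒪 𝒪') hι hT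
    (map_fittingIdeal_le_span_of_selmer_congruences_divisible ψ L₀ a ρf hdivf hglobf hlocf Mg ρg
      hdivg hglobg hlocg θ (PowerSeries 𝒪') ha Lg hCh hc)

end PowerSeries

end Summit.BirchSwinnertonDyer.Rank1Residual.X11b.TorsionControl

/-! ### §4 The crux's divisibility conjunct, divisible-invariants + torsion-only form -/

namespace Summit.BirchSwinnertonDyer.Rank1Residual.X11b.AcSelmer.XAc

open CategoryTheory Literature.NumberTheory.GaloisRepresentations IsLocalRing NumberField
  IsDedekindDomain Field TorsionControl PowerSeries
open scoped ContRepresentation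

/-- **ROAD FF, KERNEL GLUE — divisible-invariants + torsion-only form.** Twin of
`map_charIdeal_le_span_of_roadFF_torsion` (p475740) with erratum Lemma 2.1's hypotheses (F5) in
the shape `selmerTorsionEquiv` consumes: `M_f`, `M_{g_m}` are `a`-divisible and their global ∕
constrained-local invariants are `a^m`-DIVISIBLE (zero invariants — irreducibility of `ρ̄|_{G_K}`
and (iv) at `Γ₀ = G_{K,S}`, `L₀ = {𝔭}` — or all of `M` at inertia indices acting trivially). With
F1 (`hSh`), F2 (`θ`), F3 (`hc`), F4 (`hCh`), F7 (`hSig` ∕ `hP` ∕ `hLS`), torsionness of `X_f` and the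
receptacle condition `j ∘ (𝒪⟦T⟧ → 𝒪'⟦T⟧) ∘ i = PowerSeries.map (R1.toCpInt p)`: the crux conjunct
`Ch_Λ(X^∅_ac)·𝓞_{ℂ_p}⟦T⟧ ⊆ (Q)` VERBATIM. CONDITIONAL on its hypotheses only; closes nothing; BSD
proved for no pair. [cite: Castella2018Erratum, Thm. 1.1 ⇐ Thm. 2.3, proof p. 4, read one-sidedly, Lemma 2.2 bypassed]
[cite: Skinner2016PacificMC, §3.1 (p. 192)] [cite: Castella2018, (3.1) and Thm. 3.1]
[cite: JetchevSkinnerWan2017, Prop. 3.3.2 and Thm. 6.1.6 (proof)] -/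
theorem map_charIdeal_le_span_of_roadFF_divisible
    {K : Type} [Field K] [NumberField K] (W : WeierstrassCurve K) (p : ℕ) [Fact p.Prime]
    (κ : ZpExtension K p) (𝔭 : HeightOneSpectrum (𝓞 K)) (Sg : Set (HeightOneSpectrum (𝓞 K)))
    (γ : absoluteGaloisGroup K) [Fact (κ.IsTopGenerator γ)]
    -- receptacle
    {𝒪 : Type} [CommRing 𝒪] [IsDomain 𝒪] [IsDiscreteValuationRing 𝒪]
    [TopologicalSpace (PowerSeries 𝒪)]
    {𝒪' : Type} [CommRing 𝒪'] [IsDomain 𝒪'] [IsPrincipalIdealRing 𝒪'] [Algebra 𝒪 𝒪']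
    (hι : Function.Injective (algebraMap 𝒪 𝒪'))
    (i : IwasawaAlgebra p →+* PowerSeries 𝒪) (j : PowerSeries 𝒪' →+* PowerSeries 𝓞_ℂ_[p])
    (hcomp : j.comp ((algebraMap (PowerSeries 𝒪) (PowerSeries 𝒪')).comp i) =
      PowerSeries.map (R1.toCpInt p))
    (a : PowerSeries 𝒪) (ha : (Ideal.span {a}).map (algebraMap (PowerSeries 𝒪) (PowerSeries 𝒪')) ≤
      (⊥ : Ideal (PowerSeries 𝒪')).jacobson)
    -- Galois side over `Λ_𝒪`
    {Γ₀ : Type} [Group Γ₀] [TopologicalSpace Γ₀] [IsTopologicalGroup Γ₀]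
    {ι₀ : Type*} {Γw : ι₀ → Type} [∀ v, Group (Γw v)] [∀ v, TopologicalSpace (Γw v)]
    [∀ v, IsTopologicalGroup (Γw v)] (ψ : ∀ v, Γw v →ₜ* Γ₀) (L₀ : Set ι₀)
    {Mf : Type} [AddCommGroup Mf] [Module (PowerSeries 𝒪) Mf] [TopologicalSpace Mf]
    [DiscreteTopology Mf] [ContinuousSMul (PowerSeries 𝒪) Mf] (ρf : ContinuousRep Γ₀ (PowerSeries 𝒪) Mf)
    (hdivf : Function.Surjective fun x : Mf => a • x)
    (hglobf : ∀ m, 1 ≤ m → ∀ w ∈ ρf.toTopRep.ρ.invariants,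
      ∃ w' ∈ ρf.toTopRep.ρ.invariants, a ^ m • w' = w)
    (hlocf : ∀ m, 1 ≤ m → ∀ v ∈ L₀, ∀ w ∈ ((ρf.restrict (ψ v)).toTopRep).ρ.invariants,
      ∃ w' ∈ ((ρf.restrict (ψ v)).toTopRep).ρ.invariants, a ^ m • w' = w)
    (Mg : ℕ → Type) [∀ m, AddCommGroup (Mg m)] [∀ m, Module (PowerSeries 𝒪) (Mg m)]
    [∀ m, TopologicalSpace (Mg m)] [∀ m, DiscreteTopology (Mg m)]
    [∀ m, ContinuousSMul (PowerSeries 𝒪) (Mg m)] (ρg : ∀ m, ContinuousRep Γ₀ (PowerSeries 𝒪) (Mg m))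
    (hdivg : ∀ m, 1 ≤ m → Function.Surjective fun x : Mg m => a • x)
    (hglobg : ∀ m, 1 ≤ m → ∀ w ∈ (ρg m).toTopRep.ρ.invariants,
      ∃ w' ∈ (ρg m).toTopRep.ρ.invariants, a ^ m • w' = w)
    (hlocg : ∀ m, 1 ≤ m → ∀ v ∈ L₀, ∀ w ∈ (((ρg m).restrict (ψ v)).toTopRep).ρ.invariants,
      ∃ w' ∈ (((ρg m).restrict (ψ v)).toTopRep).ρ.invariants, a ^ m • w' = w)
    (θ : ∀ m, 1 ≤ m → ((torsionRep (ρg m) (a ^ m)).toTopRep ≅ (torsionRep ρf (a ^ m)).toTopRep))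
    [Module.Finite (PowerSeries 𝒪) (CharacterModule (selmer ψ L₀ ρf))]
    [∀ m, Module.Finite (PowerSeries 𝒪) (CharacterModule (selmer ψ L₀ (ρg m)))]
    -- F1 (Shapiro, inequality direction) and F7 (Σ-removal)
    (hSh : (XAc.charIdeal W p κ 𝔭 Sg γ).map i ≤
      Literature.NumberTheory.EllipticCurves.Module.charIdeal (PowerSeries 𝒪)
        (CharacterModule (selmer ψ L₀ ρf)))
    {PS : IwasawaAlgebra p}
    (hSig : XAc.charIdeal W p κ 𝔭 Sg γ = XAc.charIdeal W p κ 𝔭 ∅ γ * Ideal.span {PS})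
    (hP : algebraMap (PowerSeries 𝒪) (PowerSeries 𝒪') (i PS) ≠ 0)
    {LS Lf : PowerSeries 𝒪'}
    (hLS : Ideal.span {LS} = Ideal.span {algebraMap (PowerSeries 𝒪) (PowerSeries 𝒪') (i PS) * Lf})
    -- F4 and F3 in `𝒪'⟦T⟧`, torsionness of `X_f`
    (Lg : ℕ → PowerSeries 𝒪')
    (hCh : ∀ m, 1 ≤ m → Module.IsTorsion (PowerSeries 𝒪) (CharacterModule (selmer ψ L₀ (ρg m))) →
      (Literature.NumberTheory.EllipticCurves.Module.charIdeal (PowerSeries 𝒪)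
        (CharacterModule (selmer ψ L₀ (ρg m)))).map
        (algebraMap (PowerSeries 𝒪) (PowerSeries 𝒪')) ≤ Ideal.span {Lg m})
    (hc : ∀ m, 1 ≤ m →
      Ideal.span {Lg m} ⊔ ((Ideal.span {a}).map (algebraMap (PowerSeries 𝒪) (PowerSeries 𝒪'))) ^ m =
        Ideal.span {LS} ⊔ ((Ideal.span {a}).map (algebraMap (PowerSeries 𝒪) (PowerSeries 𝒪'))) ^ m)
    (hT : Module.IsTorsion (PowerSeries 𝒪) (CharacterModule (selmer ψ L₀ ρf)))
    -- the frame in the final receptacle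
    {Q : PowerSeries 𝓞_ℂ_[p]} (hQ : Ideal.span {j Lf} = Ideal.span {Q}) :
    (XAc.charIdeal W p κ 𝔭 ∅ γ).map (PowerSeries.map (R1.toCpInt p)) ≤ Ideal.span {Q} := by
  have h𝔠 := map_charIdeal_le_span_of_selmer_congruences_divisible ψ L₀ hι a ρf hdivf hglobf hlocf
    Mg ρg hdivg hglobg hlocg θ ha Lg hCh hc hT
  rw [← hcomp]
  exact CongruenceLimit.map_le_span_of_transfer_of_imprimitive i
    (algebraMap (PowerSeries 𝒪) (PowerSeries 𝒪')) j hSig hP hSh h𝔠 hLS hQ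

end Summit.BirchSwinnertonDyer.Rank1Residual.X11b.AcSelmer.XAc

end
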